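import Literature.Analysis.FluidPDE.FractionalNSPrescribedEnergyIteration
import Literature.Analysis.FluidPDE.FractionalNSReynoldsLimit
import Literature.Analysis.FluidPDE.FracNSGalerkinCompactness
import Literature.Analysis.FluidPDE.AnomalousDissipationProofs
import HarnessLib

/-!
# The starting triple of the Colombo–De Lellis–De Rosa scheme (CDLDR 2018, Lemma 3.1)

Analysis/FluidPDE file (definitions with bodies and proved theorems only; no named facts).
M. Colombo, C. De Lellis, L. De Rosa, *Ill-posedness of Leray solutions for the hypodissipative
Navier–Stokes equations*, Comm. Math. Phys. 362 (2018) = arXiv:1708.05666, §3.1, Lemma 3.1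
(p. 6–7 of the held arXiv text) specify the triple `(v₀, p₀, R̊₀)` from which the convex-integration
iteration of their Prop. 3.2 (the tree's named fact `ColomboDeLellisDeRosa2018_prop32`,
`FractionalNSPrescribedEnergyIteration`) starts: "`p₀ = 0`,
`v₀(x,t) = (2π)^{-3/2} (e(t)(1-δ₁))^{1/2} (cos λ̄x₃, sin λ̄x₃, 0)` and `R̊₀ = R̊₀,₁ + R̊₀,₂`, where
`R̊₀,₁ = (2π)^{-3/2} λ̄⁻¹ d/dt (e(t)(1-δ₁))^{1/2} S`, `R̊₀,₂ = (2π)^{-3/2} λ̄^{-1+2α} (e(t)(1-δ₁))^{1/2} S`,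
`S = [[0,0,sin λ̄x₃],[0,0,-cos λ̄x₃],[sin λ̄x₃,-cos λ̄x₃,0]]`, and `λ̄` is an integer whose choice
will be specified later"; "(29) and (30) are trivial, whereas (26) [the fractional
Navier–Stokes–Reynolds system] can be easily checked".

This file makes "can be easily checked" a theorem, on the tree's unit torus `𝕋³ = (ℝ/ℤ)³`
(symbol `(2π|k|)^{2α}`, probability measure; cf. the normalisation notes of
`FractionalNSPrescribedEnergyIteration`), for an ARBITRARY smooth amplitude `g` and integer
frequency `n ≥ 1`:

* `CDLDR.shearVelocity n g t = g(t) P_n`, with `P_n(y) = (sin 2πn y₁, 0, cos 2πn y₁)` the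
  circularly polarised shear mode `PulsedShear.profile n` of `AnomalousDissipationProofs`
  (the printed `(cos λ̄x₃, sin λ̄x₃, 0)` up to relabelling the axes);
* `CDLDR.stressProfile n`, the symmetric trace-free tensor `S_n(y)` with columns
  `Re(e^{2πin y₁} σⱼ)`, `σ₀ = (0,-1,0)`, `σ₁ = (-1,0,-i)`, `σ₂ = (0,-i,0)`, i.e.
  `S_n = [[0,-cos,0],[-cos,0,sin],[0,sin,0]](2πn y₁)`, which satisfies `div S_n = 2πn P_n`
  (`CDLDR.tensorDivergence_stressProfile`);
* `CDLDR.shearStress α n g t = (g'(t)/(2πn) + (2πn)^{2α-1} g(t)) S_n` (= `R̊₀,₁ + R̊₀,₂`);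
* `CDLDR.isFracNSReynoldsOn_shear` — **Lemma 3.1, "(26) can be easily checked"**: for every
  `α`, `n ≥ 1` and `g` smooth on an open `V ⊇ S`, the triple
  `(shearVelocity n g, 0, shearStress α n g)` solves the fractional Navier–Stokes–Reynolds
  system `Torus.IsFracNSReynoldsOn S α 1` (`(v₀·∇)v₀ = 0`, `(-Δ)^α v₀ = (2πn)^{2α} v₀`,
  `∂ₜv₀ = g' P_n`, `div S_n = 2πn P_n`);
* the pointwise identities and bounds behind (31), (35), (37), (28) of the source at `q = 0`:
  `‖v₀(t,y)‖ = |g(t)|`, `∫‖v₀(t)‖² = g(t)²`, `‖∂ⱼv₀‖ ≤ 2√2 πn |g|`, `‖R̊₀‖ ≤ √2 |g'/(2πn) + (2πn)^{2α-1}g|`,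
  `‖∂ⱼR̊₀‖ ≤ 2√2 πn |·|`, and `∂ₜR̊₀ + (v₀·∇)R̊₀ = (coef)' S_n`;
* `CDLDR.startAmp e δ t = ((1-δ) e(t))^{1/2}`, the printed amplitude, with its first two
  derivatives bounded in terms of the profile bounds of `IsEnergyProfileFamily`
  (`|g'| ≤ √c₀ E₁/T₀`, `|g''| ≤ √c₀ (E₂ + 2E₁²)/T₀²` on `[0,T₀]` when `c₀/2 ≤ e ≤ c₀`,
  `|e'| ≤ c₀E₁/T₀`, `|e''| ≤ c₀E₂/T₀²`), the exact energy `∫‖v₀(t)‖² = (1-δ₁)e(t)` (so (35) holds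
  with zero defect at `q = 0`), and the common initial slice for profiles with common `e(0)`
  (§8.3: "the velocity `v_{e,0}` … have the same initial value").

The parameter inequalities of Lemma 3.1 ((38)–(51): the choice of `λ̄` against `a, b, c`) are
NOT in this file; they belong with the proof of Prop. 3.2.

## References

* M. Colombo, C. De Lellis, L. De Rosa, Comm. Math. Phys. 362 (2018) = arXiv:1708.05666, §3.1
  Lemma 3.1 and its proof (pp. 6–7), §8.3 (82) (p. 19). [`ColomboDelellisDerosa2018`]
* E. Bruè, M. Colombo, G. Crippa, C. De Lellis, M. Sorella, arXiv:2212.08413 (the shear mode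
  `PulsedShear.profile` is the tree's, from `AnomalousDissipationProofs`). [`BCCDS2024`]
-/

noncomputable section

open MeasureTheory Set Filter Function UnitAddTorus
open scoped ENNReal NNReal InnerProductSpace ContDiff

namespace Literature.Analysis.FluidPDE

namespace CDLDR

open FunctionSpaces FunctionSpaces.Torus PulsedShear

-- The torus calculus operators are written fully qualified (`FunctionSpaces.Torus.partialDeriv`, …):
-- the whole-space operators `FluidPDE.convect`, `FluidPDE.partialDeriv`, `FluidPDE.timeDerivWithin`
-- of `VectorCalculus` / `ClassicalSolution` would otherwise take precedence in this namespace.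

/-- The flat three-torus `𝕋³ = (ℝ/ℤ)³`, local notation. -/
local notation "𝕋³" => UnitAddTorus (Fin 3)

/-- Euclidean `ℝ³`, local notation. -/
local notation "ℝ³" => EuclideanSpace ℝ (Fin 3)

/-- Complex `ℂ³`, local notation. -/
local notation "ℂ³" => EuclideanSpace ℂ (Fin 3)

/-! ## The shear mode `P_n`: complements to `PulsedShear.profile` -/

/-- The components of the shear mode: `P_n(y) = (Im e, 0, Re e)` with `e = e^{2πi n y₁}`, i.e.
`(sin 2πn y₁, 0, cos 2πn y₁)`. [folklore] -/
theorem profile_apply_zero (n : ℕ) (y : 𝕋³) : profile n y 0 = (mFourier (freq n) y).im := by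
  rw [profile, realTrigPoly_apply_coord, trigPoly_apply_coord, Finset.sum_singleton, pol_apply_zero]
  simp

/-- The third component of the shear mode is `Re e^{2πi n y₁} = cos 2πn y₁`. [folklore] -/
theorem profile_apply_two (n : ℕ) (y : 𝕋³) : profile n y 2 = (mFourier (freq n) y).re := by
  rw [profile, realTrigPoly_apply_coord, trigPoly_apply_coord, Finset.sum_singleton, pol_apply_two,
    mul_one]

/-- The shear mode has unit length pointwise: `‖P_n(y)‖ = 1` (`sin² + cos² = 1`). [folklore] -/
theorem norm_profile (n : ℕ) (y : 𝕋³) : ‖profile n y‖ = 1 := by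
  have hsq : (mFourier (freq n) y).re * (mFourier (freq n) y).re +
      (mFourier (freq n) y).im * (mFourier (freq n) y).im = 1 := by
    rw [← Complex.normSq_apply, ← Complex.sq_norm, norm_mFourier_freq, one_pow]
  have h2 : ‖profile n y‖ ^ 2 = 1 := by
    rw [EuclideanSpace.norm_sq_eq, Fin.sum_univ_three, profile_apply_zero, profile_apply_one,
      profile_apply_two]
    simp only [Real.norm_eq_abs, sq_abs, norm_zero, ne_eq, OfNat.ofNat_ne_zero, not_false_eq_true,
      zero_pow, add_zero]
    linear_combination hsq
  exact (pow_eq_one_iff_of_nonneg (norm_nonneg _) two_ne_zero).1 h2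

/-- `‖z‖ = √2` for the polarisation vector `z = (-i, 0, 1)`. [folklore] -/
theorem norm_pol : ‖pol‖ = Real.sqrt 2 := by
  rw [← norm_pol_sq, Real.sqrt_sq (norm_nonneg _)]

/-- `(-Δ)^α P_n = (2πn)^{2α} P_n`: the shear mode is an eigenfunction of every fractional
Laplacian (single real mode at frequency `n e₁`, `Torus.fracLaplacian_realTrigPoly_singleton`).
[folklore] -/
theorem fracLaplacian_profile (α : ℝ) (n : ℕ) (y : 𝕋³) :
    Torus.fracLaplacian α (profile n) y = ((2 * Real.pi * n) ^ (2 * α)) • profile n y := by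
  rw [profile, Torus.fracLaplacian_realTrigPoly_singleton, Torus.fracSymbol, freqNormSq_freq]
  congr 1
  rw [show (4 * Real.pi ^ 2 * (n : ℝ) ^ 2) = (2 * Real.pi * n) ^ 2 by ring, ← Real.rpow_two,
    ← Real.rpow_mul (by positivity)]

/-! ## The stress profile `S_n` with `div S_n = 2πn P_n` -/

/-- The column polarisations `σ₀ = (0,-1,0)`, `σ₁ = (-1,0,-i)`, `σ₂ = (0,-i,0)` of the stress
profile (so that `S_n = [[0,-cos,0],[-cos,0,sin],[0,sin,0]](2πn y₁)`, the tree version of the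
printed `[[0,0,sin],[0,0,-cos],[sin,-cos,0]](λ̄x₃)`). [cite: ColomboDelellisDerosa2018, §3.1 (proof of Lemma 3.1)] -/
def stressPol (j : Fin 3) : ℂ³ :=
  WithLp.toLp 2 (![![0, -1, 0], ![-1, 0, -Complex.I], ![0, -Complex.I, 0]] j)

/-- `(σ₀)₀ = 0`. [folklore] -/
@[simp] theorem stressPol_zero_zero : stressPol 0 0 = 0 := by simp [stressPol]
/-- `(σ₀)₁ = -1`. [folklore] -/
@[simp] theorem stressPol_zero_one : stressPol 0 1 = -1 := by simp [stressPol]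
/-- `(σ₀)₂ = 0`. [folklore] -/
@[simp] theorem stressPol_zero_two : stressPol 0 2 = 0 := by simp [stressPol]
/-- `(σ₁)₀ = -1`. [folklore] -/
@[simp] theorem stressPol_one_zero : stressPol 1 0 = -1 := by simp [stressPol]
/-- `(σ₁)₁ = 0`. [folklore] -/
@[simp] theorem stressPol_one_one : stressPol 1 1 = 0 := by simp [stressPol]
/-- `(σ₁)₂ = -i`. [folklore] -/
@[simp] theorem stressPol_one_two : stressPol 1 2 = -Complex.I := by simp [stressPol]
/-- `(σ₂)₀ = 0`. [folklore] -/
@[simp] theorem stressPol_two_zero : stressPol 2 0 = 0 := by simp [stressPol]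
/-- `(σ₂)₁ = -i`. [folklore] -/
@[simp] theorem stressPol_two_one : stressPol 2 1 = -Complex.I := by simp [stressPol]
/-- `(σ₂)₂ = 0`. [folklore] -/
@[simp] theorem stressPol_two_two : stressPol 2 2 = 0 := by simp [stressPol]

/-- The polarisation matrix is symmetric: `(σⱼ)ᵢ = (σᵢ)ⱼ`. [folklore] -/
theorem stressPol_symm (i j : Fin 3) : stressPol i j = stressPol j i := by
  fin_cases i <;> fin_cases j <;> simp

/-- `‖σⱼ‖ ≤ √2` for every column polarisation. [folklore] -/
theorem norm_stressPol_le (j : Fin 3) : ‖stressPol j‖ ≤ Real.sqrt 2 := by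
  rw [← Real.sqrt_sq (norm_nonneg (stressPol j))]
  refine Real.sqrt_le_sqrt ?_
  rw [EuclideanSpace.norm_sq_eq, Fin.sum_univ_three]
  fin_cases j
  · simp
  · simp only [Fin.mk_one, stressPol_one_zero, norm_neg, norm_one, one_pow, stressPol_one_one, norm_zero,
      ne_eq, OfNat.ofNat_ne_zero, not_false_eq_true, zero_pow, add_zero, stressPol_one_two, Complex.norm_I]
    norm_num
  · simp

/-- The key algebraic identity behind `div S_n = 2πn P_n`: `(2πi n) σ₁ = (2πn) z` with
`z = (-i,0,1)` the polarisation of the shear mode (`i σ₁ = z`). [folklore] -/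
theorem deriv_coeff_stressPol_one (n : ℕ) :
    (2 * Real.pi * Complex.I * ((freq n 1 : ℤ) : ℂ)) • stressPol 1 = ((2 * Real.pi * n : ℝ) : ℂ) • pol := by
  ext i
  fin_cases i
  · simp only [Fin.zero_eta, PiLp.smul_apply, stressPol_one_zero, smul_eq_mul, mul_neg, mul_one,
      pol_apply_zero, freq_apply_one, Int.cast_natCast, Complex.ofReal_mul, Complex.ofReal_ofNat,
      Complex.ofReal_natCast]
    ring
  · simp
  · simp only [Fin.reduceFinMk, PiLp.smul_apply, stressPol_one_two, smul_eq_mul, mul_neg, pol_apply_two,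
      mul_one, freq_apply_one, Int.cast_natCast, Complex.ofReal_mul, Complex.ofReal_ofNat,
      Complex.ofReal_natCast]
    linear_combination (-(2 : ℂ) * Real.pi * n) * Complex.I_mul_I

/-- **The stress profile** `S_n : 𝕋³ → (Fin 3 → ℝ³)` (stored by columns): the `j`-th column is
the real mode `Re(e^{2πi n y₁} σⱼ)`. [cite: ColomboDelellisDerosa2018, §3.1 (proof of Lemma 3.1)] -/
def stressProfile (n : ℕ) (y : 𝕋³) (j : Fin 3) : ℝ³ :=
  realTrigPoly {freq n} (fun _ => stressPol j) y

/-- Unfolding a column of the stress profile. [folklore] -/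
theorem stressProfile_col (n : ℕ) (j : Fin 3) :
    (fun y => stressProfile n y j) = realTrigPoly {freq n} (fun _ => stressPol j) := rfl

/-- The stress profile is smooth. [folklore] -/
theorem isSmooth_stressProfile (n : ℕ) : IsSmooth (stressProfile n) :=
  contDiff_pi.2 fun j => isSmooth_realTrigPoly {freq n} (fun _ => stressPol j)

/-- The entries of the stress profile: `(S_n(y))ⱼᵢ = Re(e^{2πiny₁} (σⱼ)ᵢ)`. [folklore] -/
theorem stressProfile_apply (n : ℕ) (y : 𝕋³) (j i : Fin 3) :
    stressProfile n y j i = (mFourier (freq n) y * stressPol j i).re := by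
  rw [stressProfile, realTrigPoly_apply_coord, trigPoly_apply_coord, Finset.sum_singleton]

/-- The stress profile is a symmetric tensor. [folklore] -/
theorem stressProfile_symm (n : ℕ) (y : 𝕋³) (i j : Fin 3) :
    stressProfile n y i j = stressProfile n y j i := by
  rw [stressProfile_apply, stressProfile_apply, stressPol_symm]

/-- The stress profile is trace free (all diagonal entries vanish). [folklore] -/
theorem stressProfile_diag (n : ℕ) (y : 𝕋³) (i : Fin 3) : stressProfile n y i i = 0 := by
  rw [stressProfile_apply]
  fin_cases i <;> simp

/-- Pointwise bound on the columns: `‖S_n(y) eⱼ‖ ≤ √2`. [folklore] -/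
theorem norm_stressProfile_col_le (n : ℕ) (y : 𝕋³) (j : Fin 3) : ‖stressProfile n y j‖ ≤ Real.sqrt 2 :=
  (norm_realTrigPoly_singleton_le (freq n) (fun _ => stressPol j) y).trans (norm_stressPol_le j)

/-- Pointwise bound on the stress profile (sup over columns): `‖S_n(y)‖ ≤ √2`. [folklore] -/
theorem norm_stressProfile_le (n : ℕ) (y : 𝕋³) : ‖stressProfile n y‖ ≤ Real.sqrt 2 :=
  (pi_norm_le_iff_of_nonneg (Real.sqrt_nonneg 2)).2 fun j => norm_stressProfile_col_le n y j

/-- Partial derivatives of the columns: `∂ᵢ (S_n eⱼ) = Re(e^{2πiny₁} (2πi kᵢ) σⱼ)`. [folklore] -/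
theorem partialDeriv_stressProfile_col (n : ℕ) (i j : Fin 3) (y : 𝕋³) :
    FunctionSpaces.Torus.partialDeriv i (fun y => stressProfile n y j) y =
      EuclideanSpace.realPart (mFourier (freq n) y • ((2 * Real.pi * Complex.I * ((freq n i : ℤ) : ℂ)) • stressPol j)) := by
  rw [stressProfile_col, partialDeriv_realTrigPoly, realTrigPoly_singleton_apply]

/-- The columns depend on `y₁` only: `∂ᵢ (S_n eⱼ) = 0` for `i ≠ 1`. [folklore] -/
theorem partialDeriv_stressProfile_col_of_ne_one (n : ℕ) {i : Fin 3} (hi : i ≠ 1) (j : Fin 3) (y : 𝕋³) :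
    FunctionSpaces.Torus.partialDeriv i (fun y => stressProfile n y j) y = 0 := by
  rw [partialDeriv_stressProfile_col]
  have : freq n i = 0 := by simp [freq, hi]
  simp [this]

/-- `‖∂ᵢ (S_n eⱼ)(y)‖ ≤ 2πn √2`. [folklore] -/
theorem norm_partialDeriv_stressProfile_col_le (n : ℕ) (i j : Fin 3) (y : 𝕋³) :
    ‖FunctionSpaces.Torus.partialDeriv i (fun y => stressProfile n y j) y‖ ≤ 2 * Real.pi * n * Real.sqrt 2 := by
  have h := norm_partialDeriv_realTrigPoly_singleton_le (freq n) (fun _ => stressPol j) i y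
  rw [freqNormSq_freq, Real.sqrt_sq (Nat.cast_nonneg n)] at h
  refine (le_of_eq_of_le (by rw [stressProfile_col]) h).trans ?_
  gcongr
  exact norm_stressPol_le j

/-- Columns commute with partial derivatives of the (smooth) stress profile. [folklore] -/
theorem partialDeriv_stressProfile_apply (n : ℕ) (i : Fin 3) (y : 𝕋³) (j : Fin 3) :
    FunctionSpaces.Torus.partialDeriv i (stressProfile n) y j = FunctionSpaces.Torus.partialDeriv i (fun y => stressProfile n y j) y :=
  (partialDeriv_clm_comp (isSmooth_stressProfile n)
    (ContinuousLinearMap.proj (R := ℝ) (φ := fun _ : Fin 3 => ℝ³) j) i y).symm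

/-- `‖∂ᵢ S_n (y)‖ ≤ 2πn √2` (sup over columns). [folklore] -/
theorem norm_partialDeriv_stressProfile_le (n : ℕ) (i : Fin 3) (y : 𝕋³) :
    ‖FunctionSpaces.Torus.partialDeriv i (stressProfile n) y‖ ≤ 2 * Real.pi * n * Real.sqrt 2 := by
  refine (pi_norm_le_iff_of_nonneg (by positivity)).2 fun j => ?_
  rw [partialDeriv_stressProfile_apply]
  exact norm_partialDeriv_stressProfile_col_le n i j y

/-- `∂ᵢ S_n = 0` for `i ≠ 1`. [folklore] -/
theorem partialDeriv_stressProfile_of_ne_one (n : ℕ) {i : Fin 3} (hi : i ≠ 1) (y : 𝕋³) :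
    FunctionSpaces.Torus.partialDeriv i (stressProfile n) y = 0 := by
  funext j
  rw [partialDeriv_stressProfile_apply, partialDeriv_stressProfile_col_of_ne_one n hi]
  rfl

/-- **`div S_n = 2πn P_n`**: the stress profile inverts the FunctionSpaces.Torus.divergence on the shear mode
("`div R̊₀,₁ = ∂ₜv₀`, `div R̊₀,₂ = (-Δ)^α v₀`" in the proof of Lemma 3.1).
[cite: ColomboDelellisDerosa2018, §3.1 (proof of Lemma 3.1, "(26) can be easily checked")] -/
theorem tensorDivergence_stressProfile (n : ℕ) (y : 𝕋³) :
    Torus.tensorDivergence (stressProfile n) y = (2 * Real.pi * n) • profile n y := by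
  rw [Torus.tensorDivergence, Fin.sum_univ_three,
    partialDeriv_stressProfile_col_of_ne_one n (by decide : (0 : Fin 3) ≠ 1),
    partialDeriv_stressProfile_col_of_ne_one n (by decide : (2 : Fin 3) ≠ 1), zero_add, add_zero,
    partialDeriv_stressProfile_col, deriv_coeff_stressPol_one, profile, realTrigPoly_singleton_apply,
    Complex.coe_smul, smul_comm (mFourier (freq n) y) (2 * Real.pi * (n : ℝ)) pol, map_smul]

/-! ## The shear-flow triple with an arbitrary amplitude -/

variable {α : ℝ} {n : ℕ} {g : ℝ → ℝ} {V S : Set ℝ}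

/-- The velocity `v₀(t) = g(t) P_n`. [cite: ColomboDelellisDerosa2018, §3.1 (proof of Lemma 3.1)] -/
def shearVelocity (n : ℕ) (g : ℝ → ℝ) : ℝ → 𝕋³ → ℝ³ := fun t => g t • profile n

/-- The scalar coefficient `g'(t)/(2πn) + (2πn)^{2α-1} g(t)` of the stress
(`R̊₀,₁ + R̊₀,₂ = coef · S`). [cite: ColomboDelellisDerosa2018, §3.1 (proof of Lemma 3.1)] -/
def shearCoef (α : ℝ) (n : ℕ) (g : ℝ → ℝ) (t : ℝ) : ℝ :=
  deriv g t / (2 * Real.pi * n) + (2 * Real.pi * n) ^ (2 * α - 1) * g t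

/-- The stress `R̊₀(t) = (g'(t)/(2πn) + (2πn)^{2α-1} g(t)) S_n`.
[cite: ColomboDelellisDerosa2018, §3.1 (proof of Lemma 3.1)] -/
def shearStress (α : ℝ) (n : ℕ) (g : ℝ → ℝ) : ℝ → 𝕋³ → Fin 3 → ℝ³ := fun t => shearCoef α n g t • stressProfile n

/-- Unfolding the velocity. [folklore] -/
@[simp] theorem shearVelocity_apply (n : ℕ) (g : ℝ → ℝ) (t : ℝ) (y : 𝕋³) :
    shearVelocity n g t y = g t • profile n y := rfl

/-- Unfolding the stress. [folklore] -/
@[simp] theorem shearStress_apply (α : ℝ) (n : ℕ) (g : ℝ → ℝ) (t : ℝ) (y : 𝕋³) :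
    shearStress α n g t y = shearCoef α n g t • stressProfile n y := rfl

/-- `‖v₀(t,y)‖ = |g(t)|`. [folklore] -/
theorem norm_shearVelocity (n : ℕ) (g : ℝ → ℝ) (t : ℝ) (y : 𝕋³) : ‖shearVelocity n g t y‖ = |g t| := by
  rw [shearVelocity_apply, norm_smul, norm_profile, mul_one, Real.norm_eq_abs]

/-- `∫ ‖v₀(t)‖² = g(t)²` (the torus has volume one and `‖P_n‖ ≡ 1`). [folklore] -/
theorem integral_norm_sq_shearVelocity (n : ℕ) (g : ℝ → ℝ) (t : ℝ) :
    ∫ y, ‖shearVelocity n g t y‖ ^ 2 = g t ^ 2 := by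
  simp_rw [norm_shearVelocity, sq_abs]
  simp

/-- `‖R̊₀(t,y)‖ ≤ √2 |coef(t)|`. [folklore] -/
theorem norm_shearStress_le (α : ℝ) (n : ℕ) (g : ℝ → ℝ) (t : ℝ) (y : 𝕋³) :
    ‖shearStress α n g t y‖ ≤ Real.sqrt 2 * |shearCoef α n g t| := by
  rw [shearStress_apply, norm_smul, Real.norm_eq_abs, mul_comm]
  exact mul_le_mul_of_nonneg_right (norm_stressProfile_le n y) (abs_nonneg _)

/-- The profile is `C¹` as a tensor field. [folklore] -/
theorem isContDiff_stressProfile (n : ℕ) : IsContDiff 1 (stressProfile n) :=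
  (isSmooth_stressProfile n).isContDiff (by simp)

/-- `∂ᵢ v₀(t) = g(t) ∂ᵢ P_n`, hence `‖∂ᵢ v₀(t,y)‖ ≤ 2√2 πn |g(t)|`. [folklore] -/
theorem norm_partialDeriv_shearVelocity_le (n : ℕ) (g : ℝ → ℝ) (i : Fin 3) (t : ℝ) (y : 𝕋³) :
    ‖FunctionSpaces.Torus.partialDeriv i (shearVelocity n g t) y‖ ≤ 2 * Real.pi * n * Real.sqrt 2 * |g t| := by
  rw [shearVelocity, partialDeriv_const_smul (isContDiff_profile n), Pi.smul_apply, norm_smul,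
    Real.norm_eq_abs, mul_comm]
  refine mul_le_mul_of_nonneg_right ?_ (abs_nonneg _)
  rw [← norm_pol]
  exact norm_partialDeriv_profile_le n i y

/-- `∂ᵢ v₀ = 0` for `i ≠ 1` (the flow depends on `y₁` only). [folklore] -/
theorem partialDeriv_shearVelocity_of_ne_one (n : ℕ) (g : ℝ → ℝ) {i : Fin 3} (hi : i ≠ 1) (t : ℝ) (y : 𝕋³) :
    FunctionSpaces.Torus.partialDeriv i (shearVelocity n g t) y = 0 := by
  rw [shearVelocity, partialDeriv_const_smul (isContDiff_profile n), Pi.smul_apply,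
    partialDeriv_profile_of_ne_one n hi, smul_zero]

/-- `‖∂ᵢ R̊₀(t,y)‖ ≤ 2√2 πn |coef(t)|`. [folklore] -/
theorem norm_partialDeriv_shearStress_le (α : ℝ) (n : ℕ) (g : ℝ → ℝ) (i : Fin 3) (t : ℝ) (y : 𝕋³) :
    ‖FunctionSpaces.Torus.partialDeriv i (shearStress α n g t) y‖ ≤ 2 * Real.pi * n * Real.sqrt 2 * |shearCoef α n g t| := by
  rw [shearStress, partialDeriv_const_smul (isContDiff_stressProfile n), Pi.smul_apply, norm_smul,
    Real.norm_eq_abs, mul_comm]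
  exact mul_le_mul_of_nonneg_right (norm_partialDeriv_stressProfile_le n i y) (abs_nonneg _)

/-- Shear flows have no self-advection: `(v₀·∇)v₀ = 0`. [folklore] -/
theorem convect_shearVelocity (n : ℕ) (g : ℝ → ℝ) (t : ℝ) (y : 𝕋³) :
    FunctionSpaces.Torus.convect (shearVelocity n g t) (shearVelocity n g t) y = 0 := by
  have h1 : IsContDiff 1 (shearVelocity n g t) := (isContDiff_profile n).smul (g t)
  unfold FunctionSpaces.Torus.convect
  rw [fderiv_apply_eq_sum_partialDeriv h1]
  refine Finset.sum_eq_zero fun i _ => ?_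
  by_cases hi : i = 1
  · subst hi
    simp [profile_apply_one]
  · rw [partialDeriv_shearVelocity_of_ne_one n g hi, smul_zero]

/-- The stress is merely transported by the flow: `(v₀·∇)R̊₀ = 0`. [folklore] -/
theorem convect_shearStress (α : ℝ) (n : ℕ) (g : ℝ → ℝ) (t : ℝ) (y : 𝕋³) :
    FunctionSpaces.Torus.convect (shearVelocity n g t) (shearStress α n g t) y = 0 := by
  have h1 : IsContDiff 1 (shearStress α n g t) := (isContDiff_stressProfile n).smul _
  unfold FunctionSpaces.Torus.convect
  rw [fderiv_apply_eq_sum_partialDeriv h1]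
  refine Finset.sum_eq_zero fun i _ => ?_
  by_cases hi : i = 1
  · subst hi
    simp [profile_apply_one]
  · rw [shearStress, partialDeriv_const_smul (isContDiff_stressProfile n), Pi.smul_apply,
      partialDeriv_stressProfile_of_ne_one n hi, smul_zero, smul_zero]

/-- `div v₀(t) = g(t) div P_n = 0`. [folklore] -/
theorem isDivFree_shearVelocity (n : ℕ) (g : ℝ → ℝ) (t : ℝ) : FunctionSpaces.Torus.IsDivFree (shearVelocity n g t) := by
  intro y
  have hP := isDivFree_profile n y
  unfold FunctionSpaces.Torus.divergence at hP ⊢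
  rw [← mul_zero (g t), ← hP, Finset.mul_sum]
  refine Finset.sum_congr rfl fun i _ => ?_
  have hPi : IsContDiff 1 (fun y => profile n y i) :=
    (EuclideanSpace.proj i : ℝ³ →L[ℝ] ℝ).contDiff.comp (isContDiff_profile n)
  have h : (fun y => (shearVelocity n g t) y i) = g t • fun y => profile n y i := by
    funext y
    simp
  rw [h, partialDeriv_const_smul hPi, Pi.smul_apply, smul_eq_mul]

/-- `(-Δ)^α v₀(t) = (2πn)^{2α} v₀(t)`. [folklore] -/
theorem fracLaplacian_shearVelocity (α : ℝ) (n : ℕ) (g : ℝ → ℝ) (t : ℝ) (y : 𝕋³) :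
    Torus.fracLaplacian α (shearVelocity n g t) y = (g t * (2 * Real.pi * n) ^ (2 * α)) • profile n y := by
  rw [shearVelocity, Torus.fracLaplacian_const_smul_apply, fracLaplacian_profile, smul_smul]

/-- `div R̊₀(t) = (coef(t) · 2πn) P_n`. [folklore] -/
theorem tensorDivergence_shearStress (α : ℝ) (n : ℕ) (g : ℝ → ℝ) (t : ℝ) (y : 𝕋³) :
    Torus.tensorDivergence (shearStress α n g t) y = (shearCoef α n g t * (2 * Real.pi * n)) • profile n y := by
  rw [shearStress, Torus.tensorDivergence_const_smul (isContDiff_stressProfile n), tensorDivergence_stressProfile,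
    smul_smul]

/-- The algebra of the momentum equation: `coef · 2πn = g' + (2πn)^{2α} g` for `n ≥ 1`. [folklore] -/
theorem shearCoef_mul (α : ℝ) {n : ℕ} (hn : 1 ≤ n) (g : ℝ → ℝ) (t : ℝ) :
    shearCoef α n g t * (2 * Real.pi * n) = deriv g t + g t * (2 * Real.pi * n) ^ (2 * α) := by
  have hpos : 0 < 2 * Real.pi * n := by
    have : (1 : ℝ) ≤ n := by exact_mod_cast hn
    positivity
  have key : (2 * Real.pi * n) ^ (2 * α - 1) * (2 * Real.pi * n) = (2 * Real.pi * n) ^ (2 * α) := by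
    rw [← Real.rpow_add_one hpos.ne', sub_add_cancel]
  rw [shearCoef, add_mul, div_mul_cancel₀ _ hpos.ne', mul_right_comm, key]
  ring

/-- Space–time lifts of separated tensor fields `c(t) S_n(y)` are smooth where `c` is. [folklore] -/
theorem contDiffOn_stLift_smul_stressProfile {c : ℝ → ℝ} {V : Set ℝ} (hc : ContDiffOn ℝ ∞ c V) (n : ℕ) :
    ContDiffOn ℝ ∞ (stLift (fun t => c t • stressProfile n)) (V ×ˢ univ) := by
  have h : stLift (fun t => c t • stressProfile n) =
      fun p : ℝ × EuclideanSpace ℝ (Fin 3) => c p.1 • lift (stressProfile n) p.2 := by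
    funext p; rfl
  rw [h]
  exact (hc.comp contDiffOn_fst fun p hp => (mem_prod.1 hp).1).smul
    ((isSmooth_stressProfile n).comp_contDiffOn contDiffOn_snd)

/-- Space–time lifts of separated fields `c(t) P_n(y)` are smooth where `c` is. [folklore] -/
theorem contDiffOn_stLift_smul_profile {c : ℝ → ℝ} {V : Set ℝ} (hc : ContDiffOn ℝ ∞ c V) (n : ℕ) :
    ContDiffOn ℝ ∞ (stLift (fun t => c t • profile n)) (V ×ˢ univ) := by
  have h : stLift (fun t => c t • profile n) =
      fun p : ℝ × EuclideanSpace ℝ (Fin 3) => c p.1 • lift (profile n) p.2 := by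
    funext p; rfl
  rw [h]
  exact (hc.comp contDiffOn_fst fun p hp => (mem_prod.1 hp).1).smul
    ((isSmooth_profile n).comp_contDiffOn contDiffOn_snd)

/-- The coefficient of the stress is smooth on any open set where the amplitude is. [folklore] -/
theorem contDiffOn_shearCoef (α : ℝ) (n : ℕ) (hV : IsOpen V) (hg : ContDiffOn ℝ ∞ g V) :
    ContDiffOn ℝ ∞ (shearCoef α n g) V := by
  have hd : ContDiffOn ℝ ∞ (deriv g) V := hg.deriv_of_isOpen hV le_rfl
  have h1 : ContDiffOn ℝ ∞ (fun t => deriv g t / (2 * Real.pi * n)) V := hd.div_const _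
  have h2 : ContDiffOn ℝ ∞ (fun t => (2 * Real.pi * n) ^ (2 * α - 1) * g t) V := contDiffOn_const.mul hg
  exact h1.add h2

/-- The time derivative of the velocity within a time set `S ⊆ V` of unique differentiability:
`∂ₜ v₀ = g' P_n`. [folklore] -/
theorem timeDerivWithin_shearVelocity (hV : IsOpen V) (hSV : S ⊆ V) (hS : UniqueDiffOn ℝ S)
    (hg : ContDiffOn ℝ ∞ g V) {t : ℝ} (ht : t ∈ S) (y : 𝕋³) :
    FunctionSpaces.Torus.timeDerivWithin S (shearVelocity n g) t y = deriv g t • profile n y := by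
  have hdiff : DifferentiableAt ℝ g t :=
    (hg.differentiableOn (by simp)).differentiableAt (hV.mem_nhds (hSV ht))
  have h : HasDerivWithinAt (fun τ => shearVelocity n g τ y) (deriv g t • profile n y) S t :=
    (hdiff.hasDerivAt.smul_const (profile n y)).hasDerivWithinAt
  exact h.derivWithin (hS t ht)

/-- The time derivative of the stress: `∂ₜ R̊₀ = coef' S_n`. [folklore] -/
theorem timeDerivWithin_shearStress (hV : IsOpen V) (hSV : S ⊆ V) (hS : UniqueDiffOn ℝ S)
    (hg : ContDiffOn ℝ ∞ g V) {t : ℝ} (ht : t ∈ S) (y : 𝕋³) :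
    FunctionSpaces.Torus.timeDerivWithin S (shearStress α n g) t y = deriv (shearCoef α n g) t • stressProfile n y := by
  have hdiff : DifferentiableAt ℝ (shearCoef α n g) t :=
    ((contDiffOn_shearCoef α n hV hg).differentiableOn (by simp)).differentiableAt (hV.mem_nhds (hSV ht))
  have h : HasDerivWithinAt (fun τ => shearStress α n g τ y) (deriv (shearCoef α n g) t • stressProfile n y) S t :=
    (hdiff.hasDerivAt.smul_const (stressProfile n y)).hasDerivWithinAt
  exact h.derivWithin (hS t ht)

/-- **Colombo–De Lellis–De Rosa 2018, Lemma 3.1: the starting triple solves the fractional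
Navier–Stokes–Reynolds system** ("(26) can be easily checked", proof of Lemma 3.1): for every
exponent `α`, every integer frequency `n ≥ 1` and every amplitude `g` smooth on an open set
`V ⊇ S` of times (`S` a set of unique differentiability, e.g. `[0,T₀]`), the triple
`v₀ = g P_n`, `p₀ = 0`, `R̊₀ = (g'/(2πn) + (2πn)^{2α-1}g) S_n` is a smooth solution of
`∂ₜv₀ + div(v₀⊗v₀) + ∇p₀ + (-Δ)^α v₀ = div R̊₀`, `div v₀ = 0` on `S × 𝕋³`
(`Torus.IsFracNSReynoldsOn S α 1`, viscosity `1`), with `R̊₀` symmetric (and trace free,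
`stressProfile_diag`). Indeed `∂ₜv₀ = g'P_n`, `(v₀·∇)v₀ = 0`, `(-Δ)^αv₀ = (2πn)^{2α}v₀` and
`div S_n = 2πn P_n`. [cite: ColomboDelellisDerosa2018, §3.1 Lemma 3.1 (proof, "(26) can be easily checked")] -/
theorem isFracNSReynoldsOn_shear (α : ℝ) (hn : 1 ≤ n) (hV : IsOpen V) (hSV : S ⊆ V)
    (hS : UniqueDiffOn ℝ S) (hg : ContDiffOn ℝ ∞ g V) :
    Torus.IsFracNSReynoldsOn S α 1 (shearVelocity n g) (fun _ _ => 0) (shearStress α n g) where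
  smooth_velocity := (contDiffOn_stLift_smul_profile hg n).mono (prod_mono hSV subset_rfl)
  smooth_pressure := contDiffOn_const
  smooth_stress := (contDiffOn_stLift_smul_stressProfile (contDiffOn_shearCoef α n hV hg) n).mono
    (prod_mono hSV subset_rfl)
  momentum t ht y := by
    rw [timeDerivWithin_shearVelocity hV hSV hS hg ht, convect_shearVelocity, Torus.gradient_zero,
      fracLaplacian_shearVelocity, tensorDivergence_shearStress, shearCoef_mul α hn, add_zero, add_zero,
      one_smul, ← add_smul]
  divFree t _ := isDivFree_shearVelocity n g t
  symm _ _ y i j := by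
    rw [shearStress_apply, Pi.smul_apply, Pi.smul_apply, PiLp.smul_apply, PiLp.smul_apply,
      stressProfile_symm]

/-- **The transport derivative of the stress**: `∂ₜR̊₀ + (v₀·∇)R̊₀ = coef' S_n` ("Observe that
`(v₀·∇)R̊₀ = 0`", proof of (33) in Lemma 3.1), hence
`‖∂ₜR̊₀ + (v₀·∇)R̊₀‖ ≤ √2 |coef'|`. [cite: ColomboDelellisDerosa2018, §3.1 (proof of Lemma 3.1, "Proof of (33)")] -/
theorem norm_transport_shearStress_le (hV : IsOpen V) (hSV : S ⊆ V) (hS : UniqueDiffOn ℝ S)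
    (hg : ContDiffOn ℝ ∞ g V) {t : ℝ} (ht : t ∈ S) (y : 𝕋³) :
    ‖FunctionSpaces.Torus.timeDerivWithin S (shearStress α n g) t y + FunctionSpaces.Torus.convect (shearVelocity n g t) (shearStress α n g t) y‖ ≤
      Real.sqrt 2 * |deriv (shearCoef α n g) t| := by
  rw [timeDerivWithin_shearStress hV hSV hS hg ht, convect_shearStress, add_zero, norm_smul,
    Real.norm_eq_abs, mul_comm]
  exact mul_le_mul_of_nonneg_right (norm_stressProfile_le n y) (abs_nonneg _)


/-! ## The printed amplitude `g(t) = ((1-δ₁) e(t))^{1/2}` -/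

section Amplitude

variable {e : ℝ → ℝ} {δ c₀ T₀ E₁ E₂ : ℝ}

/-- The amplitude `((1-δ) e(t))^{1/2}` of the starting velocity of Lemma 3.1
("`v₀(x,t) = (2π)^{-3/2}(e(t)(1-δ₁))^{1/2}(cos λ̄x₃, sin λ̄x₃, 0)`").
[cite: ColomboDelellisDerosa2018, §3.1 (proof of Lemma 3.1)] -/
def startAmp (e : ℝ → ℝ) (δ : ℝ) (t : ℝ) : ℝ :=
  Real.sqrt ((1 - δ) * e t)

/-- Unfolding `startAmp`. [folklore] -/
theorem startAmp_def (e : ℝ → ℝ) (δ t : ℝ) : startAmp e δ t = Real.sqrt ((1 - δ) * e t) := rfl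

/-- The amplitude is non-negative. [folklore] -/
theorem startAmp_nonneg (e : ℝ → ℝ) (δ t : ℝ) : 0 ≤ startAmp e δ t := Real.sqrt_nonneg _

/-- `g(t)² = (1-δ) e(t)` when `δ ≤ 1` and `e(t) ≥ 0`. [folklore] -/
theorem startAmp_sq (hδ : δ ≤ 1) {t : ℝ} (het : 0 ≤ e t) : startAmp e δ t ^ 2 = (1 - δ) * e t :=
  Real.sq_sqrt (mul_nonneg (by linarith) het)

/-- The starting velocity at time `0` only depends on `e(0)` (and on `n`, `δ`): profiles with a
common value at `0` give a common initial slice ("the velocity `v_{e,0}` … have the same initial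
value `v_{e,0}(·,0)` for every `e ∈ 𝓔`", §8.3). [cite: ColomboDelellisDerosa2018, §8.3 (p. 19)] -/
theorem shearVelocity_startAmp_zero_eq {e₁ e₂ : ℝ → ℝ} (h : e₁ 0 = e₂ 0) (n : ℕ) (δ : ℝ) :
    shearVelocity n (startAmp e₁ δ) 0 = shearVelocity n (startAmp e₂ δ) 0 := by
  funext y
  simp [startAmp_def, h]

/-- **The energy of the starting velocity is exactly `(1-δ₁) e(t)`**, so that (35) holds at `q = 0`
with zero defect: `∫‖v₀(t)‖² = (1-δ₁) e(t)`. [cite: ColomboDelellisDerosa2018, §3 (35) at `q = 0`] -/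
theorem integral_norm_sq_shearVelocity_startAmp (hδ : δ ≤ 1) {t : ℝ} (het : 0 ≤ e t) (n : ℕ) :
    ∫ y, ‖shearVelocity n (startAmp e δ) t y‖ ^ 2 = (1 - δ) * e t := by
  rw [integral_norm_sq_shearVelocity, startAmp_sq hδ het]

/-- Upper bound: `g(t) ≤ √c₀` when `0 ≤ e(t) ≤ c₀` and `0 ≤ δ`. [folklore] -/
theorem startAmp_le_sqrt (hδ0 : 0 ≤ δ) {t : ℝ} (het : 0 ≤ e t) (hup : e t ≤ c₀) :
    startAmp e δ t ≤ Real.sqrt c₀ := by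
  rw [startAmp_def]
  refine Real.sqrt_le_sqrt ?_
  nlinarith

/-- Lower bound: `√c₀/2 ≤ g(t)` when `c₀/2 ≤ e(t)` and `δ ≤ 1/2`. [folklore] -/
theorem half_sqrt_le_startAmp (hδ : δ ≤ 1 / 2) (hc₀ : 0 ≤ c₀) {t : ℝ} (hlo : c₀ / 2 ≤ e t) :
    Real.sqrt c₀ / 2 ≤ startAmp e δ t := by
  rw [startAmp_def]
  calc Real.sqrt c₀ / 2 = Real.sqrt ((Real.sqrt c₀ / 2) ^ 2) := (Real.sqrt_sq (by positivity)).symm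
    _ ≤ Real.sqrt ((1 - δ) * e t) := Real.sqrt_le_sqrt (by
        nlinarith [mul_nonneg hc₀ (by linarith : (0:ℝ) ≤ 1 / 2 - δ),
          mul_nonneg (by linarith : (0:ℝ) ≤ 1 / 2 - δ) (by linarith : (0:ℝ) ≤ e t - c₀ / 2),
          Real.sq_sqrt hc₀])

/-- The open set of times where `e > c₀/4`; it contains the window `[0,T₀]` when `e ≥ c₀/2`
there and `c₀ > 0`, and the amplitude is smooth on it. [folklore] -/
theorem isOpen_preimage_Ioi (he : Continuous e) (r : ℝ) : IsOpen (e ⁻¹' Ioi r) :=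
  isOpen_Ioi.preimage he

/-- `[0,T₀] ⊆ {e > c₀/4}` when `e ≥ c₀/2` on `[0,T₀]` and `c₀ > 0`. [folklore] -/
theorem Icc_subset_preimage_Ioi (hc₀ : 0 < c₀) (hlo : ∀ t ∈ Icc 0 T₀, c₀ / 2 ≤ e t) :
    Icc 0 T₀ ⊆ e ⁻¹' Ioi (c₀ / 4) := fun t ht => by
  have := hlo t ht
  show c₀ / 4 < e t
  linarith

/-- The amplitude is smooth on `{e > c₀/4}` for `c₀ ≥ 0`, `δ < 1` and smooth `e` (the square
root is smooth away from `0`). [folklore] -/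
theorem contDiffOn_startAmp (he : ContDiff ℝ ∞ e) (hδ : δ < 1) (hc₀ : 0 ≤ c₀) :
    ContDiffOn ℝ ∞ (startAmp e δ) (e ⁻¹' Ioi (c₀ / 4)) := by
  intro t ht
  have het : c₀ / 4 < e t := ht
  have hpos : (1 - δ) * e t ≠ 0 := (mul_pos (by linarith) (by linarith)).ne'
  have h1 : ContDiffAt ℝ ∞ (fun t => (1 - δ) * e t) t := (contDiffAt_const.mul he.contDiffAt)
  exact ((Real.contDiffAt_sqrt hpos).comp t h1).contDiffWithinAt

/-- **First derivative of the amplitude**: `g' = (1-δ) e' / (2g)` where `e(t) > 0`, `δ < 1`. [folklore] -/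
theorem hasDerivAt_startAmp (he : Differentiable ℝ e) (hδ : δ < 1) {t : ℝ} (het : 0 < e t) :
    HasDerivAt (startAmp e δ) ((1 - δ) * deriv e t / (2 * startAmp e δ t)) t := by
  have hpos : (1 - δ) * e t ≠ 0 := (mul_pos (by linarith) het).ne'
  have h1 : HasDerivAt (fun t => (1 - δ) * e t) ((1 - δ) * deriv e t) t :=
    ((he t).hasDerivAt).const_mul (1 - δ)
  exact h1.sqrt hpos

/-- `g' = (1-δ) e'/(2g)` as an identity of functions on `{e > c₀/4}` (`c₀ ≥ 0`). [folklore] -/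
theorem deriv_startAmp_eq (he : Differentiable ℝ e) (hδ : δ < 1) (hc₀ : 0 ≤ c₀) {t : ℝ}
    (ht : t ∈ e ⁻¹' Ioi (c₀ / 4)) :
    deriv (startAmp e δ) t = (1 - δ) * deriv e t / (2 * startAmp e δ t) := by
  have het : c₀ / 4 < e t := ht
  exact (hasDerivAt_startAmp he hδ (by linarith)).deriv

/-- **Bound on `g'`**: `|g'(t)| ≤ √c₀ E₁ / T₀` on the window, from `|e'| ≤ c₀E₁/T₀`,
`c₀/2 ≤ e ≤ c₀` and `0 ≤ δ ≤ 1/2` (proof of Lemma 3.1: `‖R̊₀,₁‖₀ ≲ λ̄⁻¹ ‖e‖_{C¹}`). [folklore] -/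
theorem abs_deriv_startAmp_le (he : Differentiable ℝ e) (hδ0 : 0 ≤ δ) (hδ : δ ≤ 1 / 2)
    (hc₀ : 0 < c₀) (hT₀ : 0 < T₀) {t : ℝ} (hlo : c₀ / 2 ≤ e t)
    (hE₁ : |deriv e t| ≤ c₀ * E₁ / T₀) :
    |deriv (startAmp e δ) t| ≤ Real.sqrt c₀ * E₁ / T₀ := by
  have het : 0 < e t := by linarith
  have hG : 0 < Real.sqrt c₀ := Real.sqrt_pos.2 hc₀
  have hG2 : Real.sqrt c₀ ^ 2 = c₀ := Real.sq_sqrt hc₀.le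
  have hg : Real.sqrt c₀ / 2 ≤ startAmp e δ t := half_sqrt_le_startAmp hδ hc₀.le hlo
  have hgpos : 0 < startAmp e δ t := lt_of_lt_of_le (by positivity) hg
  rw [(hasDerivAt_startAmp he (by linarith) het).deriv, abs_div, abs_mul, abs_of_nonneg (by linarith : (0:ℝ) ≤ 1 - δ),
    abs_of_pos (by positivity : (0:ℝ) < 2 * startAmp e δ t), div_le_div_iff₀ (by positivity) hT₀]
  have h0 : 0 ≤ c₀ * E₁ := by
    have := (abs_nonneg _).trans hE₁
    rw [le_div_iff₀ hT₀, zero_mul] at this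
    exact this
  have hE₁' : 0 ≤ E₁ := (mul_nonneg_iff_of_pos_left hc₀).1 h0
  have h2 : |deriv e t| * T₀ ≤ c₀ * E₁ := (le_div_iff₀ hT₀).1 hE₁
  have h3 : (1 - δ) * (|deriv e t| * T₀) ≤ 1 * (|deriv e t| * T₀) :=
    mul_le_mul_of_nonneg_right (by linarith) (mul_nonneg (abs_nonneg _) hT₀.le)
  calc (1 - δ) * |deriv e t| * T₀ = (1 - δ) * (|deriv e t| * T₀) := by ring
    _ ≤ c₀ * E₁ := by linarith
    _ = Real.sqrt c₀ * E₁ * Real.sqrt c₀ := by linear_combination (-E₁) * hG2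
    _ ≤ Real.sqrt c₀ * E₁ * (2 * startAmp e δ t) :=
        mul_le_mul_of_nonneg_left (by linarith) (mul_nonneg hG.le hE₁')


/-- **Second derivative of the amplitude** on `{e > c₀/4}`:
`g'' = (1-δ) e''/(2g) - (1-δ)² e'²/(4g³)`. [folklore] -/
theorem deriv_deriv_startAmp_eq (he : Differentiable ℝ e) (he' : Differentiable ℝ (deriv e)) (hδ : δ < 1)
    (hc₀ : 0 ≤ c₀) {t : ℝ} (ht : t ∈ e ⁻¹' Ioi (c₀ / 4)) :
    deriv (deriv (startAmp e δ)) t =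
      (1 - δ) * deriv (deriv e) t / (2 * startAmp e δ t) -
        (1 - δ) ^ 2 * deriv e t ^ 2 / (4 * startAmp e δ t ^ 3) := by
  have het : c₀ / 4 < e t := ht
  have hpos : 0 < e t := by linarith
  have hg : 0 < startAmp e δ t := Real.sqrt_pos.2 (mul_pos (by linarith) hpos)
  have hg' : startAmp e δ t ≠ 0 := hg.ne'
  have hV : IsOpen (e ⁻¹' Ioi (c₀ / 4)) := isOpen_preimage_Ioi he.continuous _
  have hEq : (fun s => (1 - δ) * deriv e s / (2 * startAmp e δ s)) =ᶠ[nhds t] deriv (startAmp e δ) := by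
    filter_upwards [hV.mem_nhds ht] with s hs
    exact (deriv_startAmp_eq he hδ hc₀ hs).symm
  have hN : HasDerivAt (fun s => (1 - δ) * deriv e s) ((1 - δ) * deriv (deriv e) t) t :=
    ((he' t).hasDerivAt).const_mul (1 - δ)
  have hD : HasDerivAt (fun s => 2 * startAmp e δ s) (2 * ((1 - δ) * deriv e t / (2 * startAmp e δ t))) t :=
    (hasDerivAt_startAmp he hδ hpos).const_mul 2
  have hQ := (hN.div hD (by positivity)).congr_of_eventuallyEq hEq.symm
  rw [hQ.deriv]
  field_simp
  ring

/-- **Bound on `g''`**: `|g''(t)| ≤ √c₀ (E₂ + 2E₁²)/T₀²` on the window, from `|e'| ≤ c₀E₁/T₀`,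
`|e''| ≤ c₀E₂/T₀²`, `c₀/2 ≤ e` and `0 ≤ δ ≤ 1/2` (proof of Lemma 3.1: `‖∂ₜR̊₀,₁‖₀ ≲ λ̄⁻¹‖e‖_{C²}`;
the lower-order term `E₁²` is kept explicit here). [folklore] -/
theorem abs_deriv_deriv_startAmp_le (he : Differentiable ℝ e) (he' : Differentiable ℝ (deriv e))
    (hδ0 : 0 ≤ δ) (hδ : δ ≤ 1 / 2) (hc₀ : 0 < c₀) (hT₀ : 0 < T₀) {t : ℝ} (hlo : c₀ / 2 ≤ e t)
    (hE₁ : |deriv e t| ≤ c₀ * E₁ / T₀) (hE₂ : |deriv (deriv e) t| ≤ c₀ * E₂ / T₀ ^ 2) :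
    |deriv (deriv (startAmp e δ)) t| ≤ Real.sqrt c₀ * (E₂ + 2 * E₁ ^ 2) / T₀ ^ 2 := by
  set G := Real.sqrt c₀ with hG_def
  have hG : 0 < G := Real.sqrt_pos.2 hc₀
  have hG2 : G ^ 2 = c₀ := Real.sq_sqrt hc₀.le
  have hgG : G / 2 ≤ startAmp e δ t := half_sqrt_le_startAmp hδ hc₀.le hlo
  set g := startAmp e δ t with hg_def
  have hg : 0 < g := lt_of_lt_of_le (by positivity) hgG
  have ht : t ∈ e ⁻¹' Ioi (c₀ / 4) := show c₀ / 4 < e t by linarith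
  rw [deriv_deriv_startAmp_eq he he' (by linarith) hc₀.le ht]
  set A := |deriv e t| with hA_def
  set B := |deriv (deriv e) t| with hB_def
  have hA0 : 0 ≤ A := abs_nonneg _
  have hB0 : 0 ≤ B := abs_nonneg _
  -- the two terms
  have h1 : |(1 - δ) * deriv (deriv e) t / (2 * g)| ≤ B / G := by
    rw [abs_div, abs_mul, abs_of_nonneg (by linarith : (0:ℝ) ≤ 1 - δ),
      abs_of_pos (by positivity : (0:ℝ) < 2 * g), div_le_div_iff₀ (by positivity) hG]
    nlinarith [mul_nonneg hB0 (by linarith : (0:ℝ) ≤ 2 * g - G), mul_nonneg hδ0 (mul_nonneg hB0 hG.le)]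
  have h2 : |(1 - δ) ^ 2 * deriv e t ^ 2 / (4 * g ^ 3)| ≤ 2 * A ^ 2 / G ^ 3 := by
    rw [abs_div, abs_mul, abs_of_nonneg (sq_nonneg (1 - δ)), abs_of_nonneg (sq_nonneg (deriv e t)),
      ← sq_abs (deriv e t), abs_of_pos (by positivity : (0:ℝ) < 4 * g ^ 3),
      div_le_div_iff₀ (by positivity) (by positivity)]
    have h1δ : (1 - δ) ^ 2 ≤ 1 := by nlinarith
    have hG3 : G ^ 3 ≤ 8 * g ^ 3 := by nlinarith [pow_le_pow_left₀ (by positivity) hgG 3]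
    nlinarith [mul_le_mul_of_nonneg_left hG3 (sq_nonneg A),
      mul_le_mul_of_nonneg_right h1δ (by positivity : (0:ℝ) ≤ A ^ 2 * G ^ 3)]
  -- the profile bounds
  have hB : B / G ≤ G * E₂ / T₀ ^ 2 := by
    rw [div_le_div_iff₀ hG (by positivity)]
    calc B * T₀ ^ 2 ≤ c₀ * E₂ := (le_div_iff₀ (by positivity)).1 hE₂
      _ = G * E₂ * G := by rw [← hG2]; ring
  have hA : 2 * A ^ 2 / G ^ 3 ≤ 2 * G * E₁ ^ 2 / T₀ ^ 2 := by
    rw [div_le_div_iff₀ (by positivity) (by positivity)]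
    have hAT : A * T₀ ≤ c₀ * E₁ := (le_div_iff₀ hT₀).1 hE₁
    have hAT' : (A * T₀) ^ 2 ≤ (c₀ * E₁) ^ 2 := pow_le_pow_left₀ (by positivity) hAT 2
    calc 2 * A ^ 2 * T₀ ^ 2 = 2 * (A * T₀) ^ 2 := by ring
      _ ≤ 2 * (c₀ * E₁) ^ 2 := by linarith
      _ = 2 * G * E₁ ^ 2 * G ^ 3 := by rw [← hG2]; ring
  calc |(1 - δ) * deriv (deriv e) t / (2 * g) - (1 - δ) ^ 2 * deriv e t ^ 2 / (4 * g ^ 3)|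
      ≤ |(1 - δ) * deriv (deriv e) t / (2 * g)| + |(1 - δ) ^ 2 * deriv e t ^ 2 / (4 * g ^ 3)| := abs_sub _ _
    _ ≤ B / G + 2 * A ^ 2 / G ^ 3 := add_le_add h1 h2
    _ ≤ G * E₂ / T₀ ^ 2 + 2 * G * E₁ ^ 2 / T₀ ^ 2 := add_le_add hB hA
    _ = G * (E₂ + 2 * E₁ ^ 2) / T₀ ^ 2 := by ring

/-- The derivative of the stress coefficient: `coef' = g''/(2πn) + (2πn)^{2α-1} g'` on an open
set where `g` is smooth. [folklore] -/
theorem deriv_shearCoef_eq {α : ℝ} {n : ℕ} {g : ℝ → ℝ} {V : Set ℝ} (hV : IsOpen V)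
    (hg : ContDiffOn ℝ ∞ g V) {t : ℝ} (ht : t ∈ V) :
    deriv (shearCoef α n g) t = deriv (deriv g) t / (2 * Real.pi * n) + (2 * Real.pi * n) ^ (2 * α - 1) * deriv g t := by
  have hd : ContDiffOn ℝ ∞ (deriv g) V := hg.deriv_of_isOpen hV le_rfl
  have h1 : HasDerivAt (deriv g) (deriv (deriv g) t) t :=
    ((hd.differentiableOn (by simp)).differentiableAt (hV.mem_nhds ht)).hasDerivAt
  have h2 : HasDerivAt g (deriv g t) t :=
    ((hg.differentiableOn (by simp)).differentiableAt (hV.mem_nhds ht)).hasDerivAt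
  have h : HasDerivAt (shearCoef α n g)
      (deriv (deriv g) t / (2 * Real.pi * n) + (2 * Real.pi * n) ^ (2 * α - 1) * deriv g t) t :=
    (h1.div_const _).add (h2.const_mul _)
  exact h.deriv

/-- `|coef'| ≤ |g''|/(2πn) + (2πn)^{2α-1} |g'|`. [folklore] -/
theorem abs_deriv_shearCoef_le {α : ℝ} {n : ℕ} (hn : 1 ≤ n) {g : ℝ → ℝ} {V : Set ℝ} (hV : IsOpen V)
    (hg : ContDiffOn ℝ ∞ g V) {t : ℝ} (ht : t ∈ V) :
    |deriv (shearCoef α n g) t| ≤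
      |deriv (deriv g) t| / (2 * Real.pi * n) + (2 * Real.pi * n) ^ (2 * α - 1) * |deriv g t| := by
  have hpos : 0 < 2 * Real.pi * n := by
    have : (1 : ℝ) ≤ n := by exact_mod_cast hn
    positivity
  rw [deriv_shearCoef_eq hV hg ht]
  refine (abs_add_le _ _).trans (le_of_eq ?_)
  rw [abs_div, abs_of_pos hpos, abs_mul, abs_of_pos (Real.rpow_pos_of_pos hpos _)]

/-- `|coef| ≤ |g'|/(2πn) + (2πn)^{2α-1} |g|`. [folklore] -/
theorem abs_shearCoef_le (α : ℝ) {n : ℕ} (hn : 1 ≤ n) (g : ℝ → ℝ) (t : ℝ) :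
    |shearCoef α n g t| ≤ |deriv g t| / (2 * Real.pi * n) + (2 * Real.pi * n) ^ (2 * α - 1) * |g t| := by
  have hpos : 0 < 2 * Real.pi * n := by
    have : (1 : ℝ) ≤ n := by exact_mod_cast hn
    positivity
  rw [shearCoef]
  refine (abs_add_le _ _).trans (le_of_eq ?_)
  rw [abs_div, abs_of_pos hpos, abs_mul, abs_of_pos (Real.rpow_pos_of_pos hpos _)]

end Amplitude

end CDLDR

end Literature.Analysis.FluidPDE
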